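import Literature.NumberTheory.Automorphic.TestFunctionLieDeriv
import Literature.Analysis.Calculus.SmoothAlongExp
import Literature.Analysis.Calculus.IteratedFDerivParametricIntegral
import HarnessLib

/-!
# Parametric integrals of a smooth kernel on `GL_n(𝔸_K)` along smooth archimedean families are `C^∞`
(Hörmander, *The Analysis of Linear Partial Differential Operators I*, Thm. 1.1.9; Borel–Jacquet (1979), §1.1, §4.1)

Topic `NumberTheory/Automorphic`; namespace `Literature.NumberTheory.Automorphic`. THEOREMS ONLY over accepted tree
modules (no definition, no named fact, no instance, no notation, no `sorry`). Generic number field `K`, any `n`.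

Let `η : GL_n(𝔸_K) → ℂ` be a smooth kernel (★ `IsSmoothKernelGL`: archimedean-smooth in Borel–Jacquet's chart-wise sense,
compactly supported, right invariant under an admissible finite level `{1} × U₀`). The orbital and unipotent integrals of
the trace formula integrate `η` along families `a ↦ G a x ∈ GL_n(𝔸_K)` indexed by a (locally compact, second countable)
parameter space `A` and depending on finitely many REAL variables `x ∈ V` ONLY THROUGH THE ARCHIMEDEAN COMPONENT, smoothly:
`(G a x)_∞ = M(α a, x)` for one `C^∞` map `M : W × V → M_n(K_∞)` and a continuous `α : A → W`. This file PROVES that then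
`x ↦ ∫ η(G a x) dμ(a)` is `C^∞` on `V` (`IsSmoothKernelGL.contDiff_integral_of_toMixed_eq`), the tool that discharges the
archimedean-smoothness clause of Weil's criterion for the functions `ψ` of Rogawski's unipotent terms (§7.3 of
*Automorphic Representations of Unitary Groups in Three Variables*) without any iteration of Lie derivatives:

* §1 **The zero-extended archimedean lift is globally smooth**: for every base point `g`,
  `q ↦ η(g · (q, 1))` (value `0` at non-invertible `q ∈ M_n(K_∞)`) is `C^∞` on ALL of the matrix algebra `M_n(K_∞)`
  (`IsSmoothKernelGL.contDiff_dite_isUnit`): at units by the local logarithm (★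
  `Literature.Analysis.Calculus.contDiffAt_of_contDiffAt_comp_mul_exp`, as in ★ `contDiffAt_glArchLift_of_isArchSmooth`), and
  it VANISHES NEAR every non-unit because `η` has compact support (`IsSmoothKernelGL.dite_isUnit_eventuallyEq_zero`).
* §2 **Smooth dependence of `∫ η(G a x) dμ(a)` on `x`**: with `G` jointly continuous, `(G a x)_∞ = M(α a, x)` as above and
  uniform compact supports (`η(G a x) ≠ 0 ⇒ a ∈ A_c ∧ x ∈ P_c`, `μ A_c < ∞`), the integrand is, LOCALLY IN `a`, one fixed smooth
  function of `(α a, x)` — the finite part `(G a x)_f` stays in one coset of the open level `U₀` as `x` ranges over the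
  connected `V` and as `a` ranges over a neighbourhood (right-`U`-invariance) — so `(a, x) ↦ Dⁿ_x η(G a x)` is jointly
  continuous (★ `Literature.Analysis.Calculus.continuous_iteratedFDeriv_comp_affine`), measurable in `a`, and dominated by
  `B_n · 1_{A_c}`; ★ `Literature.Analysis.Calculus.contDiff_integral_of_dominated_iteratedFDeriv` (Hörmander 1.1.9) concludes.

## References

* L. Hörmander, *The Analysis of Linear Partial Differential Operators I*, Grundlehren 256 (1983), Thm. 1.1.9 [HormanderALPDO1].
* A. Borel, H. Jacquet, *Automorphic forms and automorphic representations*, Proc. Sympos. Pure Math. 33 (1979), part 1,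
  §1.1, §4.1 [BorelJacquet1979].
* J. D. Rogawski, *Automorphic Representations of Unitary Groups in Three Variables*, Ann. of Math. Stud. 123 (1990), §7.3
  [Rogawski1990].
-/

set_option autoImplicit false

noncomputable section

open scoped MatrixGroups Matrix ContDiff Classical Topology
open NumberField NumberField.mixedEmbedding IsDedekindDomain Filter Set MeasureTheory Function

namespace Literature.NumberTheory.Automorphic

variable {n : ℕ} {K : Type} [Field K] [NumberField K]

-- the Banach algebra structure of `M_n(K_∞)` through which `IsArchSmooth` is defined
open scoped Matrix.Norms.Operator

/-! ## §1 The zero-extended archimedean lift of a smooth kernel is `C^∞` on all of `M_n(K_∞)` -/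

section Lift

/-- On invertible matrices the zero-extended lift `q ↦ η(g · (q, 1))` is `η(g · (u, 1))`. [cite: BorelJacquet1979, §4.1] -/
theorem dite_isUnit_apply_coe (η : GL (Fin n) (AdeleRing (𝓞 K) K) → ℂ) (g : GL (Fin n) (AdeleRing (𝓞 K) K))
    (u : GL (Fin n) (mixedSpace K)) :
    (fun q : Matrix (Fin n) (Fin n) (mixedSpace K) =>
        if h : IsUnit q then η (g * GLn.ofInfinite n K h.unit) else 0) (u : Matrix (Fin n) (Fin n) (mixedSpace K)) =
      η (g * GLn.ofInfinite n K u) := by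
  show (if h : IsUnit (u : Matrix (Fin n) (Fin n) (mixedSpace K)) then η (g * GLn.ofInfinite n K h.unit) else 0) = _
  rw [dif_pos (Units.isUnit u), IsUnit.unit_of_val_units]

-- `Matrix` is a type synonym of a pi type; its scoped Banach-algebra instances are found through it
-- (the idiom of Mathlib's `Matrix.isUnit_exp`, `Mathlib/Analysis/Normed/Algebra/MatrixExponential`)
set_option backward.isDefEq.respectTransparency false in
/-- **The lift is `C^∞` at every unit**: `q ↦ η(g · (q, 1))` is `C^∞` at `q = u ∈ GL_n(K_∞)` for an archimedean-smooth `η`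
(local logarithm chart at `u`, ★ `Literature.Analysis.Calculus.contDiffAt_of_contDiffAt_comp_mul_exp`; the chart function
`X ↦ η(g (u,1) (exp X, 1))` is `C^∞` by `IsArchSmooth` at the base point `g · (u, 1)`; adapted from ★
`contDiffAt_glArchLift_of_isArchSmooth` of `TestFunctionGLArchSmooth`, complex-valued). [cite: BorelJacquet1979, §1.1 and §4.1] -/
theorem IsSmoothKernelGL.contDiffAt_dite_isUnit_coe {η : GL (Fin n) (AdeleRing (𝓞 K) K) → ℂ} (hη : IsSmoothKernelGL n K η)
    (g : GL (Fin n) (AdeleRing (𝓞 K) K)) (u : GL (Fin n) (mixedSpace K)) :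
    ContDiffAt ℝ ∞ (fun q : Matrix (Fin n) (Fin n) (mixedSpace K) =>
        if h : IsUnit q then η (g * GLn.ofInfinite n K h.unit) else 0) (u : Matrix (Fin n) (Fin n) (mixedSpace K)) := by
  refine Literature.Analysis.Calculus.contDiffAt_of_contDiffAt_comp_mul_exp u ?_
  -- the commutator Lie ring structure on the matrix algebra (Mathlib's `LieRing.ofAssociativeRing`) is not a global
  -- instance in the tree's idiom; install it locally for this proof (as in ★ `contDiffOn_of_isArchSmooth`)
  letI : LieRing (Matrix (Fin n) (Fin n) (mixedSpace K)) := LieRing.ofAssociativeRing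
  letI : LieAlgebra ℝ (Matrix (Fin n) (Fin n) (mixedSpace K)) := LieAlgebra.ofAssociativeAlgebra
  -- the identity `M_n(K_∞) → 𝔤𝔩_n(K_∞)` onto the (full) Lie algebra, as a continuous linear map
  have hmem : ∀ x : Matrix (Fin n) (Fin n) (mixedSpace K), x ∈ (archGroupGL n K).lie.toSubmodule := fun x => by
    change x ∈ (archGroupGL n K).lie
    rw [archGroupGL_lie]
    exact LieSubalgebra.mem_top x
  let incl : Matrix (Fin n) (Fin n) (mixedSpace K) →L[ℝ] (archGroupGL n K).lie.toSubmodule :=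
    { toFun := fun x => ⟨x, hmem x⟩
      map_add' := fun _ _ => rfl
      map_smul' := fun _ _ => rfl
      cont := continuous_id.subtype_mk _ }
  -- the chart function at the base point `g · (u, 1)`
  have hsm : ContDiff ℝ ∞ fun X : (archGroupGL n K).lie.toSubmodule =>
      η (g * GLn.ofInfinite n K u * GLn.ofInfinite n K (expGL (X : Matrix (Fin n) (Fin n) (mixedSpace K)))) :=
    hη.isArchSmooth (g * GLn.ofInfinite n K u)
  have hcomp : ContDiff ℝ ∞ ((fun X : (archGroupGL n K).lie.toSubmodule =>
      η (g * GLn.ofInfinite n K u * GLn.ofInfinite n K (expGL (X : Matrix (Fin n) (Fin n) (mixedSpace K))))) ∘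
        (incl : Matrix (Fin n) (Fin n) (mixedSpace K) → _)) :=
    hsm.comp incl.contDiff
  have heq : (fun X : Matrix (Fin n) (Fin n) (mixedSpace K) =>
      (fun q : Matrix (Fin n) (Fin n) (mixedSpace K) => if h : IsUnit q then η (g * GLn.ofInfinite n K h.unit) else 0)
        ((u : Matrix (Fin n) (Fin n) (mixedSpace K)) * NormedSpace.exp X)) =
      ((fun X : (archGroupGL n K).lie.toSubmodule =>
        η (g * GLn.ofInfinite n K u * GLn.ofInfinite n K (expGL (X : Matrix (Fin n) (Fin n) (mixedSpace K))))) ∘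
        (incl : Matrix (Fin n) (Fin n) (mixedSpace K) → _)) := by
    funext X
    change (fun q : Matrix (Fin n) (Fin n) (mixedSpace K) => if h : IsUnit q then η (g * GLn.ofInfinite n K h.unit) else 0)
        ((u : Matrix (Fin n) (Fin n) (mixedSpace K)) * NormedSpace.exp X) =
      η (g * GLn.ofInfinite n K u * GLn.ofInfinite n K (expGL X))
    have hX : ((u : Matrix (Fin n) (Fin n) (mixedSpace K)) * NormedSpace.exp X : Matrix (Fin n) (Fin n) (mixedSpace K)) =
        ((u * expGL X : GL (Fin n) (mixedSpace K)) : Matrix (Fin n) (Fin n) (mixedSpace K)) := by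
      rw [Units.val_mul, coe_expGL]
    rw [hX, dite_isUnit_apply_coe, map_mul, mul_assoc]
  rw [heq]
  exact hcomp.contDiffAt

/-- **The lift vanishes near every non-unit.** If `q₀ ∈ M_n(K_∞)` is not invertible then `q ↦ η(g · (q, 1))` (zero-extended)
is `0` on a neighbourhood of `q₀`: the units `u` with `g · (u, 1) ∈ tsupport η` lie in the compact, hence closed, set
`((g⁻¹ · tsupport η)_∞ ⊆ M_n(K_∞))` of units, which misses `q₀`. [cite: BorelJacquet1979, §4.1] -/
theorem IsSmoothKernelGL.dite_isUnit_eventuallyEq_zero {η : GL (Fin n) (AdeleRing (𝓞 K) K) → ℂ} (hη : IsSmoothKernelGL n K η)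
    (g : GL (Fin n) (AdeleRing (𝓞 K) K)) {q₀ : Matrix (Fin n) (Fin n) (mixedSpace K)} (hq₀ : ¬ IsUnit q₀) :
    (fun q : Matrix (Fin n) (Fin n) (mixedSpace K) => if h : IsUnit q then η (g * GLn.ofInfinite n K h.unit) else 0) =ᶠ[𝓝 q₀]
      fun _ => 0 := by
  set C : Set (Matrix (Fin n) (Fin n) (mixedSpace K)) :=
    (fun z : GL (Fin n) (AdeleRing (𝓞 K) K) => ((GLn.toMixed n K (g⁻¹ * z) : GL (Fin n) (mixedSpace K)) :
      Matrix (Fin n) (Fin n) (mixedSpace K))) '' tsupport η with hC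
  have hCc : IsCompact C :=
    hη.hasCompactSupport.image (Units.continuous_val.comp ((GLn.continuous_toMixed n K).comp (continuous_const.mul continuous_id)))
  have hq₀C : q₀ ∉ C := by
    rintro ⟨z, -, hz⟩
    exact hq₀ (hz ▸ Units.isUnit _)
  filter_upwards [hCc.isClosed.isOpen_compl.mem_nhds hq₀C] with q hq
  by_cases h : IsUnit q
  · rw [dif_pos h]
    by_contra hne
    apply hq
    refine ⟨g * GLn.ofInfinite n K h.unit, subset_tsupport _ hne, ?_⟩
    show ((GLn.toMixed n K (g⁻¹ * (g * GLn.ofInfinite n K h.unit)) : GL (Fin n) (mixedSpace K)) :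
      Matrix (Fin n) (Fin n) (mixedSpace K)) = q
    rw [inv_mul_cancel_left, GLn.toMixed_ofInfinite, IsUnit.unit_spec]
  · rw [dif_neg h]

/-- **THE ZERO-EXTENDED ARCHIMEDEAN LIFT OF A SMOOTH KERNEL IS `C^∞` ON ALL OF `M_n(K_∞)`**: for `η` a smooth kernel on
`GL_n(𝔸_K)` and any base point `g`, `q ↦ η(g · (q, 1))` (value `0` off `GL_n(K_∞)`) is `C^∞` on the real Banach space
`M_n(K_∞)` (units: the logarithmic chart; non-units: locally zero). [cite: BorelJacquet1979, §1.1 and §4.1] -/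
theorem IsSmoothKernelGL.contDiff_dite_isUnit {η : GL (Fin n) (AdeleRing (𝓞 K) K) → ℂ} (hη : IsSmoothKernelGL n K η)
    (g : GL (Fin n) (AdeleRing (𝓞 K) K)) :
    ContDiff ℝ ∞ fun q : Matrix (Fin n) (Fin n) (mixedSpace K) =>
      if h : IsUnit q then η (g * GLn.ofInfinite n K h.unit) else 0 := by
  rw [contDiff_iff_contDiffAt]
  intro q
  by_cases h : IsUnit q
  · obtain ⟨u, rfl⟩ := h
    exact hη.contDiffAt_dite_isUnit_coe g u
  · exact (contDiffAt_const (c := (0 : ℂ))).congr_of_eventuallyEq (hη.dite_isUnit_eventuallyEq_zero g h)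

/-- **Right invariance moves to the base point**: for `u` in the finite level `U₀` (`η` right invariant under `{1} × U₀`),
the lifts at the base points `(1, φ u)` and `(1, φ)` coincide (`(1, u)` commutes with `(q, 1)`). [cite: BorelJacquet1979, §4.1] -/
theorem dite_isUnit_ofFinite_mul_eq {η : GL (Fin n) (AdeleRing (𝓞 K) K) → ℂ} {U₀ : Subgroup (GL (Fin n) (FiniteAdeleRing (𝓞 K) K))}
    (hηU : IsRightInvariantUnder (U₀.map (GLn.ofFinite n K)) η) (φ : GL (Fin n) (FiniteAdeleRing (𝓞 K) K))
    {u : GL (Fin n) (FiniteAdeleRing (𝓞 K) K)} (hu : u ∈ U₀) (q : Matrix (Fin n) (Fin n) (mixedSpace K)) :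
    (if h : IsUnit q then η (GLn.ofFinite n K (φ * u) * GLn.ofInfinite n K h.unit) else 0) =
      if h : IsUnit q then η (GLn.ofFinite n K φ * GLn.ofInfinite n K h.unit) else 0 := by
  by_cases h : IsUnit q
  · rw [dif_pos h, dif_pos h, map_mul, mul_assoc, ← (GLn.commute_ofInfinite_ofFinite _ _).eq, ← mul_assoc]
    exact hηU _ (Subgroup.mem_map_of_mem _ hu) _
  · rw [dif_neg h, dif_neg h]

end Lift

/-! ## §2 Smooth dependence on real parameters entering through the archimedean component -/

section Integral

variable {A : Type*} [TopologicalSpace A] [MeasurableSpace A] [OpensMeasurableSpace A] [SecondCountableTopology A]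
  {μ : Measure A}
  {V : Type*} [NormedAddCommGroup V] [NormedSpace ℝ V]
  {W : Type*} [NormedAddCommGroup W] [NormedSpace ℝ W]

/-- **The finite part stays in one coset of the level along a connected parameter.** If `x ↦ G x ∈ GL_n(𝔸_K)` is continuous
on the real normed space `V` and `U₀ ≤ GL_n(𝔸_K^∞)` is an open subgroup, then `(G 0)_f⁻¹ (G x)_f ∈ U₀` for all `x` (the set
of such `x` is clopen and contains `0`; `V` is connected; `G(𝔸) = G_∞ × G(𝔸_f)` with `G(𝔸_f)` totally disconnected).
[cite: BorelJacquet1979, §4.1] -/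
theorem sndHom_inv_mul_sndHom_mem_of_continuous {U₀ : Subgroup (GL (Fin n) (FiniteAdeleRing (𝓞 K) K))}
    (hU₀ : IsOpen (U₀ : Set (GL (Fin n) (FiniteAdeleRing (𝓞 K) K)))) {G : V → GL (Fin n) (AdeleRing (𝓞 K) K)}
    (hG : Continuous G) (x : V) : (GLn.sndHom n K (G 0))⁻¹ * GLn.sndHom n K (G x) ∈ U₀ := by
  set S : Set V := {x | (GLn.sndHom n K (G 0))⁻¹ * GLn.sndHom n K (G x) ∈ U₀} with hS
  have hc : Continuous fun x : V => (GLn.sndHom n K (G 0))⁻¹ * GLn.sndHom n K (G x) :=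
    continuous_const.mul (GLn.continuous_sndHom.comp hG)
  have hclopen : IsClopen S := ⟨(U₀.isClosed_of_isOpen hU₀).preimage hc, hU₀.preimage hc⟩
  have h0 : (0 : V) ∈ S := by
    show (GLn.sndHom n K (G 0))⁻¹ * GLn.sndHom n K (G 0) ∈ U₀
    rw [inv_mul_cancel]
    exact U₀.one_mem
  have hSu : S = univ := (isClopen_iff.1 hclopen).resolve_left (Set.nonempty_iff_ne_empty.1 ⟨0, h0⟩)
  have hx : x ∈ S := by rw [hSu]; exact mem_univ x
  exact hx

/-- **A point of `GL_n(𝔸_K)` read through the lift**: `η(z) = Λ_{(1, z_f u)}(z_∞)` for the zero-extended lift `Λ` at any base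
point `(1, z_f u)` with `u` in the finite level (`z = (z_∞, 1)(1, z_f)`, ★ `GLn.ofInfinite_toMixed_mul_ofFinite_sndHom`, and
right invariance). [cite: BorelJacquet1979, §4.1] -/
theorem eq_dite_isUnit_of_sndHom_mem {η : GL (Fin n) (AdeleRing (𝓞 K) K) → ℂ}
    {U₀ : Subgroup (GL (Fin n) (FiniteAdeleRing (𝓞 K) K))} (hηU : IsRightInvariantUnder (U₀.map (GLn.ofFinite n K)) η)
    (z : GL (Fin n) (AdeleRing (𝓞 K) K)) {φ : GL (Fin n) (FiniteAdeleRing (𝓞 K) K)} (hφ : φ⁻¹ * GLn.sndHom n K z ∈ U₀)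
    {q : Matrix (Fin n) (Fin n) (mixedSpace K)}
    (hq : ((GLn.toMixed n K z : GL (Fin n) (mixedSpace K)) : Matrix (Fin n) (Fin n) (mixedSpace K)) = q) :
    η z = if h : IsUnit q then η (GLn.ofFinite n K φ * GLn.ofInfinite n K h.unit) else 0 := by
  have hz : GLn.sndHom n K z = φ * (φ⁻¹ * GLn.sndHom n K z) := by rw [mul_inv_cancel_left]
  rw [← dite_isUnit_ofFinite_mul_eq hηU φ hφ q, ← hz, ← hq, dif_pos (Units.isUnit _), IsUnit.unit_of_val_units,
    ← (GLn.commute_ofInfinite_ofFinite _ _).eq, GLn.ofInfinite_toMixed_mul_ofFinite_sndHom]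

/-- **SMOOTH DEPENDENCE OF `∫ η(G a x) dμ(a)` ON REAL PARAMETERS ENTERING THROUGH THE ARCHIMEDEAN COMPONENT.** Let `η` be a
smooth kernel on `GL_n(𝔸_K)` (★ `IsSmoothKernelGL`), `A` a second countable topological measure space, `V`, `W` real normed
spaces, `G : A → V → GL_n(𝔸_K)` jointly continuous with archimedean component `(G a x)_∞ = M(α a, x)` for a `C^∞` map
`M : W × V → M_n(K_∞)` and a continuous `α : A → W`. If `η(G a x) ≠ 0` forces `a ∈ A_c` and `x ∈ P_c` for compact sets `A_c`
(measurable, `μ A_c < ∞`) and `P_c`, then `x ↦ ∫ η(G a x) dμ(a)` is `C^∞` on `V`. Proof: locally in `a` the integrand is ONE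
smooth function of `(α a, x)` (§1 lift at the base point `(1, (G a₀ 0)_f)`; the finite part of `G a x` stays in the coset
`(G a₀ 0)_f U₀` for `a` near `a₀` and all `x`), so `(a, x) ↦ Dⁿ_x η(G a x)` is jointly continuous, measurable in `a` and bounded
by `B_n 1_{A_c}(a)`; Hörmander's Thm. 1.1.9 (★ `Literature.Analysis.Calculus.contDiff_integral_of_dominated_iteratedFDeriv`).
[cite: HormanderALPDO1, Thm. 1.1.9] [cite: BorelJacquet1979, §4.1] -/
theorem IsSmoothKernelGL.contDiff_integral_of_toMixed_eq {η : GL (Fin n) (AdeleRing (𝓞 K) K) → ℂ} (hη : IsSmoothKernelGL n K η)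
    {G : A → V → GL (Fin n) (AdeleRing (𝓞 K) K)} (hG : Continuous (Function.uncurry G))
    {α : A → W} (hα : Continuous α) {M : W × V → Matrix (Fin n) (Fin n) (mixedSpace K)} (hM : ContDiff ℝ ∞ M)
    (hGM : ∀ a x, ((GLn.toMixed n K (G a x) : GL (Fin n) (mixedSpace K)) : Matrix (Fin n) (Fin n) (mixedSpace K)) = M (α a, x))
    {A_c : Set A} (hA_c : IsCompact A_c) (hA_cm : MeasurableSet A_c) (hμA : μ A_c < ⊤) {P_c : Set V} (hP_c : IsCompact P_c)
    (hsupp : ∀ a x, η (G a x) ≠ 0 → a ∈ A_c ∧ x ∈ P_c) :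
    ContDiff ℝ ∞ fun x => ∫ a, η (G a x) ∂μ := by
  obtain ⟨U, hU, hηU⟩ := hη.exists_level
  obtain ⟨U₀, hU₀o, -, rfl⟩ := hU
  -- the finite part at `x = 0`, continuous in `a`
  set φ : A → GL (Fin n) (FiniteAdeleRing (𝓞 K) K) := fun a => GLn.sndHom n K (G a 0) with hφ
  have hGa : ∀ a, Continuous (G a) := fun a => hG.comp (continuous_const.prodMk continuous_id)
  have hφc : Continuous φ := GLn.continuous_sndHom.comp (hG.comp (continuous_id.prodMk continuous_const))
  -- the neighbourhoods `N a₀ = {a | (φ a₀)⁻¹ φ a ∈ U₀}`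
  have hNo : ∀ a₀, IsOpen {a | (φ a₀)⁻¹ * φ a ∈ U₀} := fun a₀ => hU₀o.preimage (continuous_const.mul hφc)
  have hNself : ∀ a₀, a₀ ∈ {a | (φ a₀)⁻¹ * φ a ∈ U₀} := fun a₀ => by
    show (φ a₀)⁻¹ * φ a₀ ∈ U₀
    rw [inv_mul_cancel]
    exact U₀.one_mem
  -- the smooth functions `Φ a₀ : W × V → ℂ`
  set Φ : A → W × V → ℂ := fun a₀ p =>
    if h : IsUnit (M p) then η (GLn.ofFinite n K (φ a₀) * GLn.ofInfinite n K h.unit) else 0 with hΦ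
  have hΦs : ∀ a₀, ContDiff ℝ ∞ (Φ a₀) := fun a₀ => (hη.contDiff_dite_isUnit (GLn.ofFinite n K (φ a₀))).comp hM
  set L : V →L[ℝ] W × V := ContinuousLinearMap.inr ℝ W V with hL
  set c : A → W × V := fun a => (α a, (0 : V)) with hc
  have hcc : Continuous c := hα.prodMk continuous_const
  -- LOCAL REPRESENTATION: for `a` near `a₀`, `η (G a x) = Φ a₀ (L x + c a)` for all `x`
  have hrepr : ∀ a₀ a, a ∈ {a | (φ a₀)⁻¹ * φ a ∈ U₀} → (fun x => η (G a x)) = fun x => Φ a₀ (L x + c a) := by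
    intro a₀ a ha
    funext x
    have hLc : L x + c a = (α a, x) := by
      rw [hL, hc, ContinuousLinearMap.inr_apply, Prod.mk_add_mk, zero_add, add_zero]
    have hmem : (φ a₀)⁻¹ * GLn.sndHom n K (G a x) ∈ U₀ := by
      have h := U₀.mul_mem ha (sndHom_inv_mul_sndHom_mem_of_continuous hU₀o (hGa a) x)
      rwa [mul_assoc, mul_inv_cancel_left] at h
    rw [hLc]
    exact eq_dite_isUnit_of_sndHom_mem hηU (G a x) hmem (hGM a x)
  -- (h1) each `x ↦ η (G a x)` is smooth
  have h1 : ∀ a, ContDiff ℝ ∞ fun x => η (G a x) := fun a => by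
    rw [hrepr a a (hNself a)]
    exact (hΦs a).comp (L.contDiff.add contDiff_const)
  -- joint continuity of `(a, x) ↦ Dᵐ_x η (G a x)`
  have hD : ∀ m : ℕ, Continuous fun q : A × V => iteratedFDeriv ℝ m (fun x => η (G q.1 x)) q.2 := by
    intro m
    refine continuous_iff_continuousAt.2 fun q₀ => ?_
    have hloc : (fun q : A × V => iteratedFDeriv ℝ m (fun x => η (G q.1 x)) q.2) =ᶠ[𝓝 q₀]
        fun q : A × V => iteratedFDeriv ℝ m (fun p => Φ q₀.1 (L p + c q.1)) q.2 := by
      filter_upwards [((hNo q₀.1).prod isOpen_univ).mem_nhds ⟨hNself q₀.1, mem_univ _⟩] with q hq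
      rw [hrepr q₀.1 q.1 hq.1]
    rw [continuousAt_congr hloc]
    exact (Literature.Analysis.Calculus.continuous_iteratedFDeriv_comp_affine (hΦs q₀.1) L hcc m).continuousAt
  -- (h2) measurability in `a`
  have h2 : ∀ (m : ℕ) (x : V), AEStronglyMeasurable (fun a => iteratedFDeriv ℝ m (fun x => η (G a x)) x) μ :=
    fun m x => ((hD m).comp (continuous_id.prodMk continuous_const)).aestronglyMeasurable
  -- (h3) domination by `B_m · 1_{A_c}`
  have h3 : ∀ m : ℕ, ∃ g : A → ℝ, Integrable g μ ∧ ∀ a x, ‖iteratedFDeriv ℝ m (fun x => η (G a x)) x‖ ≤ g a := by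
    intro m
    obtain ⟨B, hB⟩ := (hA_c.prod hP_c).exists_bound_of_continuousOn (hD m).continuousOn
    refine ⟨A_c.indicator fun _ => max B 0, ?_, fun a x => ?_⟩
    · exact (integrableOn_const (C := max B 0) hμA.ne).integrable_indicator hA_cm
    by_cases ha : a ∈ A_c
    · rw [indicator_of_mem ha]
      by_cases hx : x ∈ P_c
      · exact (hB (a, x) ⟨ha, hx⟩).trans (le_max_left _ _)
      · -- off `P_c` the derivative vanishes (`tsupport ⊆ P_c`)
        have hts : tsupport (fun x => η (G a x)) ⊆ P_c :=
          closure_minimal (fun x hx => (hsupp a x hx).2) hP_c.isClosed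
        have h0 : iteratedFDeriv ℝ m (fun x => η (G a x)) x = 0 :=
          notMem_support.1 fun hmem => hx (hts (support_iteratedFDeriv_subset m hmem))
        rw [h0, norm_zero]
        exact le_max_right _ _
    · -- off `A_c` the integrand vanishes identically
      have hzero : (fun x => η (G a x)) = fun _ => (0 : ℂ) := funext fun x => by
        by_contra hne
        exact ha (hsupp a x hne).1
      rw [indicator_of_notMem ha, hzero, iteratedFDeriv_fun_zero, Pi.zero_apply, norm_zero]
  exact Literature.Analysis.Calculus.contDiff_integral_of_dominated_iteratedFDeriv h1 h2 h3

end Integral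

end Literature.NumberTheory.Automorphic
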